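import Literature.Combinatorics.SimpleGraph.CriticalGroup
import Mathlib.Order.Lattice.Nat
import HarnessLib

/-!
# Divisors on a finite graph, linear equivalence, complete linear systems `|D|` and their
# dimension `r(D)`; the canonical divisor and the genus (Baker–Norine 2007, §1.3–§1.6, Lemma 2.1)

Source (held, read at the page; statements VERBATIM). M. Baker, S. Norine, *Riemann–Roch and
Abel–Jacobi theory on a finite graph*, Adv. Math. 215 (2007) 766–788 [BakerNorine2007] (held text
`paper:doi-10-1016-j-aim-2007-04-012`, author version, pp. 4–9; arXiv:math/0608360). Throughout
B–N «a graph will mean a finite, unweighted multigraph having no loop edges. All graphs in this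
paper are assumed to be connected.» Here: a finite simple graph `G` (Mathlib `SimpleGraph`), with
connectedness as an explicit hypothesis where it is used.

§1.3 «Let `Div(G)` be the free abelian group on the set of vertices of `G`. We think of elements of
`Div(G)` as formal integer linear combinations of elements of `V(G)` […] elements of `Div(G)` are
called divisors on `G`. […] we say that `D ≥ D′` if and only if `D(v) ≥ D′(v)` for all
`v ∈ V(G)`. A divisor `E ∈ Div(G)` is called effective if `E ≥ 0`. […] The degree function
`deg : Div(G) → ℤ` is defined by `deg(D) = Σ_{v ∈ V(G)} D(v)`. […] The Laplacian operator
`Δ : 𝓜(G) → Div(G)` is given by the formula `Δ(f) = Σ_{v ∈ V(G)} Δ_v(f)(v)`, where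
`Δ_v(f) = deg(v) f(v) − Σ_{e = wv ∈ E_v} f(w)`. In terms of matrices, […] `[Δ(f)] = Q[f]`. […] We
also define the subgroup `Prin(G)` of `Div(G)` consisting of principal divisors to be the image of
`𝓜(G)` under the Laplacian operator, i.e., (1.4) `Prin(G) := Δ(𝓜(G))`. It is easy to see that
every principal divisor has degree zero, so that `Prin(G)` is a subgroup of `Div⁰(G)`. […] we
define the group `Jac(G)`, called the Jacobian of `G`, to be the corresponding quotient group:
(1.5) `Jac(G) = Div⁰(G) / Prin(G)`. As shown in [BDN], `Jac(G)` is a finite abelian group whose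
order `κ(G)` is the number of spanning trees in `G`.»

§1.6 «We define an equivalence relation `∼` on the group `Div(G)` by declaring that `D ∼ D′` if
and only if `D − D′ ∈ Prin(G)`. […] we call this relation linear equivalence. Since a principal
divisor has degree zero, it follows that linearly equivalent divisors have the same degree. […]
For `D ∈ Div(G)`, we define the linear system associated to `D` to be the set `|D|` of all
effective divisors linearly equivalent to `D`: `|D| = {E ∈ Div(G) : E ≥ 0, E ∼ D}`. […] It follows
that there is a winning strategy in the chip-firing game whose initial configuration corresponds
to `D` if and only if `|D| ≠ ∅`. We define the dimension `r(D)` of the linear system `|D|` by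
setting `r(D)` equal to `−1` if `|D| = ∅`, and then declaring that for each integer `s ≥ 0`,
`r(D) ≥ s` if and only if `|D − E| ≠ ∅` for all effective divisors `E` of degree `s`. It is clear
that `r(D)` depends only on the linear equivalence class of `D`. […] The canonical divisor on `G`
is the divisor `K` given by (1.11) `K = Σ_{v ∈ V(G)} (deg(v) − 2)(v)`. Since the sum over all
vertices `v` of `deg(v)` equals twice the number of edges in `G`, we have
`deg(K) = 2|E(G)| − 2|V(G)| = 2g − 2.» (§1.4: «Let `g = |E(G)| − |V(G)| + 1` be the genus of `G`,
which is the number of linearly independent cycles of `G`».)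

§2 «It is easy to see that `r(D) = −1` if `deg(D) < 0`, and if `deg(D) = 0` then `r(D) = 0` if
`D ∼ 0` and `r(D) = −1` otherwise. **Lemma 2.1.** For all `D, D′ ∈ Div(X)` such that
`r(D), r(D′) ≥ 0`, we have `r(D + D′) ≥ r(D) + r(D′)`. **Proof.** Let
`E₀ = (x₁) + ⋯ + (x_{r(D)+r(D′)})` be an arbitrary effective divisor of degree `r(D) + r(D′)`, and
let `E = (x₁) + ⋯ + (x_{r(D)})` and `E′ = (x_{r(D)+1}) + ⋯ + (x_{r(D)+r(D′)})`. Then `|D − E|` and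
`|D′ − E′|` are non-empty, so that `D − E ∼ F` and `D′ − E′ ∼ F′` with `F, F′ ≥ 0`. It follows that
`(D + D′) − (E + E′) = (D + D′) − E₀ ∼ F + F′ ≥ 0`, and thus `r(D + D′) ≥ r(D) + r(D′)`.»

## What is formalised (vocabulary of the tree's chip-firing files: `Q = G.lapMatrix ℤ`,
## `laplacianLattice G` = `Prin(G)` = `𝓛(Q)`, `zeroSumLattice V` = `Div⁰(G)`, and the Jacobian
## `Jac(G) = Div⁰(G)/Prin(G)` IS the tree's `criticalGroup G`, of order the tree number by
## `card_criticalGroup` — not restated)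

Divisors are integer vectors `D : V → ℤ`; `deg D` is written `∑ v, D v`; effective = `0 ≤ D`.

* `LinEquiv G D D'` («`D ∼ D′` iff `D − D′ ∈ Prin(G)`»): `linEquiv_iff_exists_eq_sub`
  (`D′ = D − Qf`), `refl`/`symm`/`trans`, (E1) `LinEquiv.sum_eq` («linearly equivalent divisors
  have the same degree»), (E2) `LinEquiv.add`/`sub`/`neg`, `linEquiv_run` (the states reached by
  firing sequences are linearly equivalent to the start, via the tree's
  `sub_run_mem_laplacianLattice`);
* `Winnable G D` («`|D| ≠ ∅`», a winning strategy exists): invariance under `∼`,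
  `Winnable.sum_nonneg` (so `|D| = ∅` when `deg D < 0`), `Winnable.add`,
  `winnable_iff_linEquiv_zero_of_sum_eq_zero` (degree `0`);
* the dimension **`rank G D`** (`r(D)`, an integer `≥ −1`), with B–N's definition as the theorems
  **`rank_eq_neg_one_iff`** («`r(D) = −1` iff `|D| = ∅`») and **`le_rank_iff`** («for each
  integer `s ≥ 0`, `r(D) ≥ s` iff `|D − E| ≠ ∅` for all effective divisors `E` of degree `s`»);
  `rank_lt_iff`, `LinEquiv.rank_eq` («depends only on the linear equivalence class»),
  `rank_lt_of_sum_lt` / `rank_le_sum`, `rank_eq_neg_one_of_sum_neg` («`r(D) = −1` if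
  `deg(D) < 0`»), `rank_eq_zero_of_linEquiv_zero` / `rank_eq_neg_one_of_not_linEquiv_zero`
  (degree `0`), and **Lemma 2.1** `rank_add_le_rank_add` (`r(D + D′) ≥ r(D) + r(D′)`), through
  the splitting lemma `exists_le_sum_eq` (an effective divisor of degree `≥ a` contains an
  effective divisor of degree `a`);
* `canonicalDivisor G` (`K(v) = deg(v) − 2`), `genus G` (`g = |E| − |V| + 1`, an integer),
  **`sum_canonicalDivisor`** («`deg(K) = 2g − 2`»), `genus_nonneg` (connected graphs).

Definitions with bodies and theorems; no `sorry`; no named facts.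
-/

open Finset SimpleGraph Matrix
open Literature.Combinatorics.SimpleGraph.ChipFiring

namespace Literature.Combinatorics.SimpleGraph.BakerNorine

variable {V : Type*} [Fintype V] [DecidableEq V] (G : SimpleGraph V) [DecidableRel G.Adj]

/-! ### §1 Linear equivalence of divisors -/

section LinEquiv

/-- **Linear equivalence** of divisors on `G`: «`D ∼ D′` if and only if `D − D′ ∈ Prin(G)`», the
principal divisors `Prin(G) = Δ(𝓜(G))` being the tree's `laplacianLattice G` (`𝓛(Q)`).
[cite: BakerNorine2007, §1.6 (and §1.3 (1.4))] -/
def LinEquiv (D D' : V → ℤ) : Prop := D - D' ∈ laplacianLattice G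

/-- Unfolding `LinEquiv`. [cite: BakerNorine2007, §1.6] -/
theorem linEquiv_iff (D D' : V → ℤ) : LinEquiv G D D' ↔ D - D' ∈ laplacianLattice G := Iff.rfl

/-- `D ∼ D′` iff `D′ = D − Δ(f)` for an integer-valued function `f` on the vertices
(«`[Δ(f)] = Q[f]`»). [cite: BakerNorine2007, §1.3 and §1.6] -/
theorem linEquiv_iff_exists_eq_sub (D D' : V → ℤ) :
    LinEquiv G D D' ↔ ∃ f : V → ℤ, D' = D - G.lapMatrix ℤ *ᵥ f := by
  rw [linEquiv_iff, mem_laplacianLattice_iff]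
  constructor
  · rintro ⟨f, hf⟩
    exact ⟨f, by rw [hf]; abel⟩
  · rintro ⟨f, hf⟩
    exact ⟨f, by rw [hf]; abel⟩

/-- `∼` is reflexive. [cite: BakerNorine2007, §1.6 («an equivalence relation»)] -/
theorem LinEquiv.refl (D : V → ℤ) : LinEquiv G D D := by
  rw [linEquiv_iff, sub_self]
  exact zero_mem _

variable {G}

/-- `∼` is symmetric. [cite: BakerNorine2007, §1.6 («an equivalence relation»)] -/
theorem LinEquiv.symm {D D' : V → ℤ} (h : LinEquiv G D D') : LinEquiv G D' D := by
  rw [linEquiv_iff] at h ⊢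
  rw [← neg_sub]
  exact neg_mem h

/-- `∼` is transitive. [cite: BakerNorine2007, §1.6 («an equivalence relation»)] -/
theorem LinEquiv.trans {D D' D'' : V → ℤ} (h : LinEquiv G D D') (h' : LinEquiv G D' D'') :
    LinEquiv G D D'' := by
  rw [linEquiv_iff] at h h' ⊢
  rw [← sub_add_sub_cancel D D' D'']
  exact add_mem h h'

variable (G) in
/-- `∼` is symmetric (iff form). [cite: BakerNorine2007, §1.6] -/
theorem linEquiv_comm {D D' : V → ℤ} : LinEquiv G D D' ↔ LinEquiv G D' D := ⟨LinEquiv.symm, LinEquiv.symm⟩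

/-- (E2) «If `D₁ ∼ D₁′` and `D₂ ∼ D₂′`, then `D₁ + D₂ ∼ D₁′ + D₂′`.»
[cite: BakerNorine2007, §2 (E2)] -/
theorem LinEquiv.add {D₁ D₁' D₂ D₂' : V → ℤ} (h₁ : LinEquiv G D₁ D₁') (h₂ : LinEquiv G D₂ D₂') :
    LinEquiv G (D₁ + D₂) (D₁' + D₂') := by
  rw [linEquiv_iff] at h₁ h₂ ⊢
  rw [add_sub_add_comm]
  exact add_mem h₁ h₂

/-- `∼` is compatible with negation. [cite: BakerNorine2007, §2 (E2)] -/
theorem LinEquiv.neg {D D' : V → ℤ} (h : LinEquiv G D D') : LinEquiv G (-D) (-D') := by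
  rw [linEquiv_iff] at h ⊢
  rw [neg_sub_neg, ← neg_sub]
  exact neg_mem h

/-- `∼` is compatible with subtraction. [cite: BakerNorine2007, §2 (E2)] -/
theorem LinEquiv.sub {D₁ D₁' D₂ D₂' : V → ℤ} (h₁ : LinEquiv G D₁ D₁') (h₂ : LinEquiv G D₂ D₂') :
    LinEquiv G (D₁ - D₂) (D₁' - D₂') := by
  rw [sub_eq_add_neg, sub_eq_add_neg]
  exact h₁.add h₂.neg

/-- Adding the same divisor to both sides. [cite: BakerNorine2007, §2 (E2)] -/
theorem LinEquiv.add_right {D D' : V → ℤ} (h : LinEquiv G D D') (F : V → ℤ) :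
    LinEquiv G (D + F) (D' + F) :=
  h.add (LinEquiv.refl G F)

/-- Subtracting the same divisor from both sides. [cite: BakerNorine2007, §2 (E2)] -/
theorem LinEquiv.sub_right {D D' : V → ℤ} (h : LinEquiv G D D') (F : V → ℤ) :
    LinEquiv G (D - F) (D' - F) :=
  h.sub (LinEquiv.refl G F)

/-- Subtracting both sides from the same divisor. [cite: BakerNorine2007, §2 (E2)] -/
theorem LinEquiv.sub_left {D D' : V → ℤ} (h : LinEquiv G D D') (F : V → ℤ) :
    LinEquiv G (F - D) (F - D') :=
  (LinEquiv.refl G F).sub h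

/-- (E1) «Since a principal divisor has degree zero, it follows that linearly equivalent divisors
have the same degree.» [cite: BakerNorine2007, §1.6] -/
theorem LinEquiv.sum_eq {D D' : V → ℤ} (h : LinEquiv G D D') : ∑ v, D v = ∑ v, D' v := by
  have h0 := laplacianLattice_le_zeroSumLattice G h
  rw [mem_zeroSumLattice_iff] at h0
  simp only [Pi.sub_apply, Finset.sum_sub_distrib] at h0
  linarith

variable (G) in
/-- The state reached from `D` by any firing sequence is linearly equivalent to `D` («two divisors
`D` and `D′` on `G` are linearly equivalent if and only if there is a sequence of moves taking `D`
to `D′` in the chip firing game» — the direction from moves to `∼`).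
[cite: BakerNorine2007, §1.6 and Lemma 4.3] -/
theorem linEquiv_run (D : V → ℤ) (σ : List V) : LinEquiv G D (run G D σ) :=
  sub_run_mem_laplacianLattice G D σ

variable (G) in
/-- A single lending move preserves the linear equivalence class.
[cite: BakerNorine2007, §1.5–§1.6 and Lemma 4.3] -/
theorem linEquiv_fire (D : V → ℤ) (v : V) : LinEquiv G D (fire G D v) :=
  linEquiv_run G D [v]

variable (G) in
/-- `D ∼ D − Qf`. [cite: BakerNorine2007, §1.3 (1.4) and §1.6] -/
theorem linEquiv_sub_mulVec (D f : V → ℤ) : LinEquiv G D (D - G.lapMatrix ℤ *ᵥ f) :=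
  (linEquiv_iff_exists_eq_sub G D _).2 ⟨f, rfl⟩

end LinEquiv

/-! ### §2 Complete linear systems: `|D| ≠ ∅` -/

section Winnable

/-- **`|D| ≠ ∅`**: `D` is linearly equivalent to an effective divisor («there is a winning
strategy in the chip-firing game whose initial configuration corresponds to `D` if and only if
`|D| ≠ ∅`»). [cite: BakerNorine2007, §1.6 (and §1.5)] -/
def Winnable (D : V → ℤ) : Prop := ∃ E : V → ℤ, 0 ≤ E ∧ LinEquiv G D E

/-- Unfolding `Winnable`. [cite: BakerNorine2007, §1.6] -/
theorem winnable_iff (D : V → ℤ) : Winnable G D ↔ ∃ E : V → ℤ, 0 ≤ E ∧ LinEquiv G D E := Iff.rfl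

variable {G}

variable (G) in
/-- An effective divisor is a winning position. [cite: BakerNorine2007, §1.5–§1.6] -/
theorem winnable_of_nonneg {D : V → ℤ} (h : 0 ≤ D) : Winnable G D := ⟨D, h, LinEquiv.refl G D⟩

variable (G) in
/-- `|0| ≠ ∅`. [cite: BakerNorine2007, §1.6] -/
theorem winnable_zero : Winnable G 0 := winnable_of_nonneg G le_rfl

/-- `|D|` depends only on the class of `D`. [cite: BakerNorine2007, §1.6] -/
theorem LinEquiv.winnable {D D' : V → ℤ} (h : LinEquiv G D D') (hD : Winnable G D) : Winnable G D' := by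
  obtain ⟨E, hE, hDE⟩ := hD
  exact ⟨E, hE, h.symm.trans hDE⟩

/-- `|D|` depends only on the class of `D` (iff form). [cite: BakerNorine2007, §1.6] -/
theorem LinEquiv.winnable_iff {D D' : V → ℤ} (h : LinEquiv G D D') : Winnable G D ↔ Winnable G D' :=
  ⟨h.winnable, h.symm.winnable⟩

/-- A winning position has non-negative degree. [cite: BakerNorine2007, §2 («`r(D) = −1` if
`deg(D) < 0`»)] -/
theorem Winnable.sum_nonneg {D : V → ℤ} (h : Winnable G D) : 0 ≤ ∑ v, D v := by
  obtain ⟨E, hE, hDE⟩ := h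
  rw [hDE.sum_eq]
  exact Finset.sum_nonneg fun v _ => hE v

variable (G) in
/-- «`r(D) = −1` if `deg(D) < 0`»: `|D| = ∅` for divisors of negative degree.
[cite: BakerNorine2007, §2] -/
theorem not_winnable_of_sum_neg {D : V → ℤ} (h : ∑ v, D v < 0) : ¬Winnable G D := by
  intro hw
  have := hw.sum_nonneg
  omega

/-- `|D| ≠ ∅` and `|D′| ≠ ∅` imply `|D + D′| ≠ ∅` («`D − E ∼ F` and `D′ − E′ ∼ F′` with
`F, F′ ≥ 0` […] `∼ F + F′ ≥ 0`»). [cite: BakerNorine2007, Lemma 2.1 (proof)] -/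
theorem Winnable.add {D D' : V → ℤ} (h : Winnable G D) (h' : Winnable G D') : Winnable G (D + D') := by
  obtain ⟨E, hE, hDE⟩ := h
  obtain ⟨E', hE', hDE'⟩ := h'
  exact ⟨E + E', add_nonneg hE hE', hDE.add hDE'⟩

/-- Adding an effective divisor to a winning position. [cite: BakerNorine2007, Lemma 2.1 (proof)] -/
theorem Winnable.add_nonneg {D F : V → ℤ} (h : Winnable G D) (hF : 0 ≤ F) : Winnable G (D + F) :=
  h.add (winnable_of_nonneg G hF)

variable (G) in
/-- In degree `0`: `|D| ≠ ∅` iff `D ∼ 0` («if `deg(D) = 0` then `r(D) = 0` if `D ∼ 0` and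
`r(D) = −1` otherwise»). [cite: BakerNorine2007, §2] -/
theorem winnable_iff_linEquiv_zero_of_sum_eq_zero {D : V → ℤ} (h : ∑ v, D v = 0) :
    Winnable G D ↔ LinEquiv G D 0 := by
  constructor
  · rintro ⟨E, hE, hDE⟩
    have hs : ∑ v, E v = 0 := by rw [← hDE.sum_eq, h]
    obtain rfl : E = 0 :=
      funext fun v => (Finset.sum_eq_zero_iff_of_nonneg fun v _ => hE v).1 hs v (mem_univ v)
    exact hDE
  · intro h0
    exact ⟨0, le_rfl, h0⟩

end Winnable

/-! ### §3 The dimension `r(D)` of `|D|` -/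

section Rank

/-- The degrees `s` of the effective divisors `E` with `|D − E| = ∅` (auxiliary: `r(D) + 1` is
the least of them). [cite: BakerNorine2007, §1.6 (definition of `r(D)`)] -/
def unwinnableDegrees (D : V → ℤ) : Set ℕ :=
  {n | ∃ E : V → ℤ, 0 ≤ E ∧ ∑ v, E v = n ∧ ¬Winnable G (D - E)}

/-- **`r(D)`**, the dimension of the complete linear system `|D|`: `−1` if `|D| = ∅`, and
otherwise the largest `s ≥ 0` such that `|D − E| ≠ ∅` for every effective `E` of degree `s`
(B–N's definition is recovered as `rank_eq_neg_one_iff` / `le_rank_iff`). Implemented as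
`(min unwinnableDegrees) − 1`. [cite: BakerNorine2007, §1.6] -/
noncomputable def rank (D : V → ℤ) : ℤ := (sInf (unwinnableDegrees G D) : ℕ) - 1

/-- `r(D) ≥ −1`. [cite: BakerNorine2007, §1.6 («`r : Div(X) → {−1, 0, 1, 2, …}`», §2)] -/
theorem neg_one_le_rank (D : V → ℤ) : -1 ≤ rank G D := by
  unfold rank
  omega

variable {G}

/-- Splitting an effective divisor: an effective `E₀` with `deg E₀ ≥ a` contains an effective `E`
of degree `a` («let `E = (x₁) + ⋯ + (x_{r(D)})` and `E′ = (x_{r(D)+1}) + ⋯`»).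
[cite: BakerNorine2007, Lemma 2.1 (proof)] -/
theorem exists_le_sum_eq {E₀ : V → ℤ} (hE₀ : 0 ≤ E₀) {a : ℕ} (ha : (a : ℤ) ≤ ∑ v, E₀ v) :
    ∃ E : V → ℤ, 0 ≤ E ∧ E ≤ E₀ ∧ ∑ v, E v = a := by
  induction a with
  | zero => exact ⟨0, le_rfl, hE₀, by simp⟩
  | succ a ih =>
    have ha' : (a : ℤ) + 1 ≤ ∑ v, E₀ v := by exact_mod_cast ha
    obtain ⟨E, hE, hEE₀, hs⟩ := ih (by omega)
    have hex : ∃ v, E v < E₀ v := by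
      by_contra hcon
      push Not at hcon
      have : ∑ v, E₀ v ≤ ∑ v, E v := Finset.sum_le_sum fun v _ => hcon v
      omega
    obtain ⟨v, hv⟩ := hex
    refine ⟨E + Pi.single v 1, fun u => ?_, fun u => ?_, ?_⟩
    · rw [Pi.add_apply]
      by_cases hu : u = v
      · subst hu
        rw [Pi.single_eq_same]
        linarith [hE u]
      · rw [Pi.single_eq_of_ne hu, add_zero]
        exact hE u
    · rw [Pi.add_apply]
      by_cases hu : u = v
      · subst hu
        rw [Pi.single_eq_same]
        exact Int.add_one_le_iff.2 hv
      · rw [Pi.single_eq_of_ne hu, add_zero]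
        exact hEE₀ u
    · simp only [Pi.add_apply, Finset.sum_add_distrib]
      rw [Finset.sum_pi_single', if_pos (mem_univ v), hs]
      push_cast
      ring

/-- A single vertex carrying `c ≥ 0` dollars is an effective divisor of degree `c`. [folklore] -/
private theorem single_nonneg_sum (v : V) {c : ℤ} (hc : 0 ≤ c) :
    (0 : V → ℤ) ≤ Pi.single v c ∧ ∑ u, Pi.single v c u = c := by
  refine ⟨fun u => ?_, by rw [Finset.sum_pi_single', if_pos (mem_univ v)]⟩
  by_cases hu : u = v
  · subst hu
    rw [Pi.single_eq_same]
    exact hc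
  · rw [Pi.zero_apply, Pi.single_eq_of_ne hu]

variable (G) in
/-- The auxiliary set is non-empty: removing more than `deg D` dollars from one vertex leaves a
divisor of negative degree. [cite: BakerNorine2007, §2 («`r(D) = −1` if `deg(D) < 0`»)] -/
theorem unwinnableDegrees_nonempty [Nonempty V] (D : V → ℤ) : (unwinnableDegrees G D).Nonempty := by
  obtain ⟨v⟩ := ‹Nonempty V›
  obtain ⟨h0, hs⟩ := single_nonneg_sum v (c := (((∑ u, D u).toNat + 1 : ℕ) : ℤ)) (by positivity)
  refine ⟨(∑ u, D u).toNat + 1, Pi.single v _, h0, hs, not_winnable_of_sum_neg G ?_⟩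
  simp only [Pi.sub_apply, Finset.sum_sub_distrib, hs]
  have := Int.self_le_toNat (∑ u, D u)
  push_cast
  omega

variable (G) in
/-- **«`r(D)` equal to `−1` if `|D| = ∅`»** (and only then). [cite: BakerNorine2007, §1.6] -/
theorem rank_eq_neg_one_iff [Nonempty V] (D : V → ℤ) : rank G D = -1 ↔ ¬Winnable G D := by
  have key : sInf (unwinnableDegrees G D) = 0 ↔ ¬Winnable G D := by
    rw [Nat.sInf_eq_zero, or_iff_left (unwinnableDegrees_nonempty G D).ne_empty]
    constructor
    · rintro ⟨E, hE, hs, hw⟩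
      have hs0 : ∑ v, E v = 0 := by exact_mod_cast hs
      obtain rfl : E = 0 :=
        funext fun v => (Finset.sum_eq_zero_iff_of_nonneg fun v _ => hE v).1 hs0 v (mem_univ v)
      rwa [sub_zero] at hw
    · intro hw
      exact ⟨0, le_rfl, by simp, by rwa [sub_zero]⟩
  rw [← key]
  unfold rank
  omega

variable (G) in
/-- `r(D) ≥ 0` iff `|D| ≠ ∅`. [cite: BakerNorine2007, §1.6 and Remark 1.10] -/
theorem rank_nonneg_iff [Nonempty V] (D : V → ℤ) : 0 ≤ rank G D ↔ Winnable G D := by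
  have h1 := neg_one_le_rank G D
  have h2 := rank_eq_neg_one_iff G D
  constructor
  · intro h
    by_contra hw
    have := h2.2 hw
    omega
  · intro hw
    by_contra h
    exact h2.1 (by omega) hw

variable (G) in
/-- **B–N's definition of `r(D)`**: «for each integer `s ≥ 0`, `r(D) ≥ s` if and only if
`|D − E| ≠ ∅` for all effective divisors `E` of degree `s`.» [cite: BakerNorine2007, §1.6] -/
theorem le_rank_iff [Nonempty V] (D : V → ℤ) (s : ℕ) :
    (s : ℤ) ≤ rank G D ↔ ∀ E : V → ℤ, 0 ≤ E → ∑ v, E v = s → Winnable G (D - E) := by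
  have hne := unwinnableDegrees_nonempty G D
  constructor
  · intro h E hE hs
    by_contra hw
    have := Nat.sInf_le (show s ∈ unwinnableDegrees G D from ⟨E, hE, hs, hw⟩)
    unfold rank at h
    omega
  · intro h
    unfold rank
    suffices hlt : s < sInf (unwinnableDegrees G D) by omega
    by_contra hge
    push Not at hge
    obtain ⟨E, hE, hs, hw⟩ := Nat.sInf_mem hne
    obtain ⟨v⟩ := ‹Nonempty V›
    obtain ⟨h0, hs'⟩ :=
      single_nonneg_sum v (c := (s : ℤ) - sInf (unwinnableDegrees G D)) (by omega)
    apply hw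
    have hw' := h (E + Pi.single v ((s : ℤ) - sInf (unwinnableDegrees G D)))
      (add_nonneg hE h0)
      (by simp only [Pi.add_apply, Finset.sum_add_distrib]; rw [hs, hs']; omega)
    have : D - E = D - (E + Pi.single v ((s : ℤ) - sInf (unwinnableDegrees G D)))
        + Pi.single v ((s : ℤ) - sInf (unwinnableDegrees G D)) := by abel
    rw [this]
    exact hw'.add_nonneg h0

variable (G) in
/-- `r(D) < s` iff some effective `E` of degree `s` has `|D − E| = ∅`.
[cite: BakerNorine2007, §1.6] -/
theorem rank_lt_iff [Nonempty V] (D : V → ℤ) (s : ℕ) :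
    rank G D < s ↔ ∃ E : V → ℤ, 0 ≤ E ∧ ∑ v, E v = s ∧ ¬Winnable G (D - E) := by
  rw [← not_le, le_rank_iff]
  push Not
  rfl

/-- «It is clear that `r(D)` depends only on the linear equivalence class of `D`.»
[cite: BakerNorine2007, §1.6] -/
theorem LinEquiv.rank_eq {D D' : V → ℤ} (h : LinEquiv G D D') : rank G D = rank G D' := by
  have hset : unwinnableDegrees G D = unwinnableDegrees G D' := by
    ext n
    simp only [unwinnableDegrees, Set.mem_setOf_eq]
    exact exists_congr fun E => and_congr_right fun _ => and_congr_right fun _ =>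
      not_congr (h.sub_right E).winnable_iff
  rw [rank, rank, hset]

variable (G) in
/-- `r(D) < s` as soon as `deg D < s`: remove `s` dollars from one vertex.
[cite: BakerNorine2007, §2 («`r(D) = −1` if `deg(D) < 0`»)] -/
theorem rank_lt_of_sum_lt [Nonempty V] {D : V → ℤ} {s : ℕ} (h : ∑ v, D v < s) : rank G D < s := by
  rw [rank_lt_iff]
  obtain ⟨v⟩ := ‹Nonempty V›
  obtain ⟨h0, hs⟩ := single_nonneg_sum v (c := (s : ℤ)) (by positivity)
  refine ⟨Pi.single v (s : ℤ), h0, hs, not_winnable_of_sum_neg G ?_⟩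
  simp only [Pi.sub_apply, Finset.sum_sub_distrib, hs]
  omega

variable (G) in
/-- `r(D) ≤ deg D` for divisors of non-negative degree. [cite: BakerNorine2007, §2] -/
theorem rank_le_sum [Nonempty V] {D : V → ℤ} (h : 0 ≤ ∑ v, D v) : rank G D ≤ ∑ v, D v := by
  have := rank_lt_of_sum_lt G (D := D) (s := (∑ v, D v).toNat + 1) (by push_cast; omega)
  push_cast at this
  omega

variable (G) in
/-- «It is easy to see that `r(D) = −1` if `deg(D) < 0`.» [cite: BakerNorine2007, §2] -/
theorem rank_eq_neg_one_of_sum_neg [Nonempty V] {D : V → ℤ} (h : ∑ v, D v < 0) : rank G D = -1 :=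
  (rank_eq_neg_one_iff G D).2 (not_winnable_of_sum_neg G h)

/-- «if `deg(D) = 0` then `r(D) = 0` if `D ∼ 0`». [cite: BakerNorine2007, §2] -/
theorem rank_eq_zero_of_linEquiv_zero [Nonempty V] {D : V → ℤ} (h : LinEquiv G D 0) : rank G D = 0 := by
  have hs : ∑ v, D v = 0 := by rw [h.sum_eq]; simp
  have h1 := rank_le_sum G hs.ge
  have h2 := (rank_nonneg_iff G D).2 ⟨0, le_rfl, h⟩
  omega

variable (G) in
/-- `r(0) = 0`. [cite: BakerNorine2007, §2] -/
theorem rank_zero [Nonempty V] : rank G (0 : V → ℤ) = 0 :=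
  rank_eq_zero_of_linEquiv_zero (LinEquiv.refl G 0)

variable (G) in
/-- «if `deg(D) = 0` then […] `r(D) = −1` otherwise» (i.e. when `D ≁ 0`).
[cite: BakerNorine2007, §2] -/
theorem rank_eq_neg_one_of_not_linEquiv_zero [Nonempty V] {D : V → ℤ} (h0 : ∑ v, D v = 0)
    (h : ¬LinEquiv G D 0) : rank G D = -1 :=
  (rank_eq_neg_one_iff G D).2 fun hw => h ((winnable_iff_linEquiv_zero_of_sum_eq_zero G h0).1 hw)

variable (G) in
/-- **Lemma 2.1.** «For all `D, D′ ∈ Div(X)` such that `r(D), r(D′) ≥ 0`, we have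
`r(D + D′) ≥ r(D) + r(D′)`.» [cite: BakerNorine2007, Lemma 2.1] -/
theorem rank_add_le_rank_add [Nonempty V] {D D' : V → ℤ} (hD : 0 ≤ rank G D) (hD' : 0 ≤ rank G D') :
    rank G D + rank G D' ≤ rank G (D + D') := by
  obtain ⟨s, hs⟩ := Int.eq_ofNat_of_zero_le hD
  obtain ⟨s', hs'⟩ := Int.eq_ofNat_of_zero_le hD'
  rw [hs, hs', ← Nat.cast_add, le_rank_iff]
  intro E₀ hE₀ hsum
  -- split `E₀ = E + E′` with `deg E = r(D)`, `deg E′ = r(D′)`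
  obtain ⟨E, hE, hEE₀, hEs⟩ := exists_le_sum_eq hE₀ (a := s) (by rw [hsum]; push_cast; omega)
  have h1 := (le_rank_iff G D s).1 hs.ge E hE hEs
  have h2 := (le_rank_iff G D' s').1 hs'.ge (E₀ - E) (fun v => sub_nonneg.2 (hEE₀ v))
    (by simp only [Pi.sub_apply, Finset.sum_sub_distrib, hsum, hEs]; push_cast; ring)
  have h12 := h1.add h2
  have : D + D' - E₀ = D - E + (D' - (E₀ - E)) := by abel
  rwa [this]

end Rank

/-! ### §4 The canonical divisor and the genus -/

section Canonical

omit [DecidableEq V] in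
/-- The **canonical divisor** «`K = Σ_{v ∈ V(G)} (deg(v) − 2)(v)`».
[cite: BakerNorine2007, §1.6 (1.11)] -/
def canonicalDivisor : V → ℤ := fun v => (G.degree v : ℤ) - 2

omit [DecidableEq V] in
/-- Unfolding `K`. [cite: BakerNorine2007, §1.6 (1.11)] -/
theorem canonicalDivisor_apply (v : V) : canonicalDivisor G v = G.degree v - 2 := rfl

omit [DecidableEq V] in
/-- The **genus** «`g = |E(G)| − |V(G)| + 1` […] the number of linearly independent cycles of
`G`» (an integer; non-negative for connected `G`, `genus_nonneg`). [cite: BakerNorine2007, §1.4] -/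
def genus : ℤ := (#G.edgeFinset : ℤ) - Fintype.card V + 1

omit [DecidableEq V] in
/-- Unfolding `g`. [cite: BakerNorine2007, §1.4] -/
theorem genus_eq : genus G = (#G.edgeFinset : ℤ) - Fintype.card V + 1 := rfl

omit [DecidableEq V] in
/-- **«`deg(K) = 2|E(G)| − 2|V(G)| = 2g − 2`»** («since the sum over all vertices `v` of
`deg(v)` equals twice the number of edges»). [cite: BakerNorine2007, §1.6] -/
theorem sum_canonicalDivisor : ∑ v, canonicalDivisor G v = 2 * genus G - 2 := by
  simp only [canonicalDivisor, genus, Finset.sum_sub_distrib, Finset.sum_const, Finset.card_univ]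
  rw [← Nat.cast_sum, G.sum_degrees_eq_twice_card_edges]
  push_cast
  ring

omit [DecidableEq V] in
/-- The genus of a connected graph is non-negative («every connected graph on `n` vertices has at
least `n − 1` edges»). [cite: BakerNorine2007, §1.4 and §2 («Let `g` be a nonnegative integer»)] -/
theorem genus_nonneg (hG : G.Connected) : 0 ≤ genus G := by
  have h := hG.card_vert_le_card_edgeSet_add_one
  rw [Nat.card_eq_fintype_card, Nat.card_eq_fintype_card, ← edgeFinset_card] at h
  rw [genus_eq]
  omega

end Canonical

end Literature.Combinatorics.SimpleGraph.BakerNorine
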